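import Literature.Topology.FourManifolds.MorseExistence
import HarnessLib

/-!
# Almost every height function of an immersed second-countable manifold is a Morse function

Topic `Literature/Topology/FourManifolds`.  Everything here is **proved**; no definitions, no named
facts.  The tree's `MorseExistence.lean` proves, for a COMPACT manifold `M` and a smooth
`e : M → ℝᴺ` with injective differential, that almost every height function `x ↦ ⟪a, e x⟫` is a
Morse function (Guillemin–Pollack, *Differential topology* (1974), Ch. 1 §7; Milnor, *Morse theory*
(1963), §6, Thm. 6.6), compactness serving only to extract finitely many charts.  Countably many
charts suffice (a countable union of null sets is null), so the same holds for every
second-countable manifold, and for any finite-dimensional real inner product space as target: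

* `isMorse_inner_of_forall` — the tree's `isMorse_height_of_forall` with target an arbitrary
  finite-dimensional inner product space `K` (same proof);
* `ae_isMorse_inner` — for `M` second countable, `e : M → K` smooth whose chart expressions have
  injective differential, and any additive Haar measure `μ` on `K`: for `μ`-almost every `a`,
  `x ↦ ⟪a, e x⟫` is a Morse function on `M`.

This is the form needed for proper Morse functions on NON-compact manifolds (Milnor 1963, §6
Thm. 6.6 is stated for any manifold embedded in Euclidean space; used for the affine variety
`ℂℙᴺ ∖ V(F)` in `Literature/AlgebraicGeometry/HodgeTheory/HypersurfaceComplementMorse.lean`).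

## References

* V. Guillemin, A. Pollack, *Differential topology* (1974; AMS Chelsea 2010), Ch. 1 §7.
  [GuilleminPollack2010]
* J. Milnor, *Morse theory*, Ann. of Math. Studies 51 (1963), §6, Thm. 6.6. [Milnor1963]
-/

open scoped Manifold ContDiff Topology RealInnerProductSpace
open Set Function Filter MeasureTheory

noncomputable section

namespace Literature.Topology.FourManifolds

section AeMorse

variable {n : ℕ} {M : Type*} [TopologicalSpace M] [ChartedSpace (EuclideanSpace ℝ (Fin n)) M]
  [IsManifold (𝓡 n) ∞ M] {K : Type*} [NormedAddCommGroup K] [InnerProductSpace ℝ K]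
  [FiniteDimensional ℝ K] {e : M → K}

/-- **A good height function is a Morse function** (Guillemin–Pollack Ch. 1 §7; the tree's
`isMorse_height_of_forall` for an arbitrary finite-dimensional target): if `e : M → K` is smooth
and `a ∈ K` is such that in each chart of a cover of `M` every critical point of
`⟪a, e ∘ chart⁻¹⟫` has injective second derivative, then `x ↦ ⟪a, e x⟫` is a Morse function.
[cite: GuilleminPollack2010, Ch. 1 §7 (proof)] -/
theorem isMorse_inner_of_forall (he : ContMDiff (𝓡 n) 𝓘(ℝ, K) ∞ e) {t : Set M}
    (ht : ∀ y : M, ∃ x ∈ t, y ∈ (chartAt (EuclideanSpace ℝ (Fin n)) x).source) {a : K}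
    (ha : ∀ x ∈ t, ∀ z ∈ (extChartAt (𝓡 n) x).target,
      fderiv ℝ (HeightFunction.height (e ∘ (extChartAt (𝓡 n) x).symm) a) z = 0 →
      Injective (fderiv ℝ (fderiv ℝ
        (HeightFunction.height (e ∘ (extChartAt (𝓡 n) x).symm) a)) z)) :
    IsMorse (𝓡 n) (fun y => ⟪a, e y⟫) := by
  haveI : IsManifold (𝓡 n) 2 M := IsManifold.of_le (n := ∞) (by norm_cast)
  set f : M → ℝ := fun y => ⟪a, e y⟫ with hf
  have hfs : ContMDiff (𝓡 n) 𝓘(ℝ, ℝ) ∞ f :=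
    (InnerProductSpace.toDual ℝ K a).contDiff.comp_contMDiff he
  refine ⟨hfs, fun y hy => ?_⟩
  obtain ⟨x, hxt, hyx⟩ := ht y
  have hf2 : ContMDiffAt (𝓡 n) 𝓘(ℝ, ℝ) 2 f y := (hfs.of_le (by norm_cast)) y
  have hchart : chartAt (EuclideanSpace ℝ (Fin n)) x ∈ IsManifold.maximalAtlas (𝓡 n) 2 M :=
    IsManifold.chart_mem_maximalAtlas x
  have hread : f ∘ ((chartAt (EuclideanSpace ℝ (Fin n)) x).extend (𝓡 n)).symm =
      HeightFunction.height (e ∘ (extChartAt (𝓡 n) x).symm) a := rfl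
  have hz : (chartAt (EuclideanSpace ℝ (Fin n)) x).extend (𝓡 n) y ∈ (extChartAt (𝓡 n) x).target :=
    (extChartAt (𝓡 n) x).map_source (by rwa [extChartAt_source])
  have hcrit : fderiv ℝ (HeightFunction.height (e ∘ (extChartAt (𝓡 n) x).symm) a)
      ((chartAt (EuclideanSpace ℝ (Fin n)) x).extend (𝓡 n) y) = 0 := by
    rw [← hread]
    exact (isMCriticalPt_iff_fderiv_comp_extend_symm_eq_zero hf2 hchart hyx).1 hy
  have hinj := ha x hxt _ hz hcrit
  refine (nondegenerate_mhessian_iff hf2 hy hchart hyx).2 ?_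
  have he2 : ContDiffOn ℝ 2 (e ∘ (extChartAt (𝓡 n) x).symm) (extChartAt (𝓡 n) x).target :=
    (contMDiffOn_iff_contDiffOn.1 (he.comp_contMDiffOn (contMDiffOn_extChartAt_symm x))).of_le
      (by norm_cast)
  have hF2 : ContDiffAt ℝ 2 (HeightFunction.height (e ∘ (extChartAt (𝓡 n) x).symm) a)
      ((chartAt (EuclideanSpace ℝ (Fin n)) x).extend (𝓡 n) y) :=
    (HeightFunction.contDiffOn_height he2 a).contDiffAt ((isOpen_extChartAt_target x).mem_nhds hz)
  have key := nondegenerate_of_injective_fderiv_fderiv hF2 hinj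
  have hH : hessianInChart (𝓡 n) (chartAt (EuclideanSpace ℝ (Fin n)) x) f y =
      (ContinuousLinearMap.coeLM ℝ).comp (fderiv ℝ (fderiv ℝ
        (HeightFunction.height (e ∘ (extChartAt (𝓡 n) x).symm) a))
        ((chartAt (EuclideanSpace ℝ (Fin n)) x).extend (𝓡 n) y)).toLinearMap := by
    ext v w
    rw [hessianInChart_apply_apply, ModelWithCorners.Boundaryless.range_eq_univ,
      fderivWithin_univ, fderivWithin_univ, hread]
    rfl
  rw [hH]
  exact key

variable [SecondCountableTopology M] [MeasurableSpace K] [BorelSpace K]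

/-- **Almost every height function of an immersed second-countable manifold is a Morse function**
(Guillemin–Pollack 1974, Ch. 1 §7; Milnor 1963, §6 Thm. 6.6; the tree's `ae_isMorse_height`
without compactness: countably many charts suffice).  Hypotheses: `e : M → K` smooth, and in
every extended chart the chart expression of `e` has injective differential.
[cite: GuilleminPollack2010, Ch. 1 §7] [cite: Milnor1963, §6 Thm. 6.6] -/
theorem ae_isMorse_inner (μ : Measure K) [μ.IsAddHaarMeasure] (he : ContMDiff (𝓡 n) 𝓘(ℝ, K) ∞ e)
    (hinj : ∀ x : M, ∀ z ∈ (extChartAt (𝓡 n) x).target,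
      Injective (fderiv ℝ (e ∘ (extChartAt (𝓡 n) x).symm) z)) :
    ∀ᵐ a ∂μ, IsMorse (𝓡 n) (fun y => ⟪a, e y⟫) := by
  -- countably many charts cover `M`
  obtain ⟨t, htc, ht⟩ := TopologicalSpace.countable_cover_nhds
    (f := fun x : M => (chartAt (EuclideanSpace ℝ (Fin n)) x).source)
    fun x => (chartAt (EuclideanSpace ℝ (Fin n)) x).open_source.mem_nhds (mem_chart_source _ x)
  have htcover : ∀ y : M, ∃ x ∈ t, y ∈ (chartAt (EuclideanSpace ℝ (Fin n)) x).source := fun y => by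
    have := ht ▸ mem_univ y
    simpa only [mem_iUnion, exists_prop] using this
  have hgood : ∀ᵐ a ∂μ, ∀ x ∈ t, ∀ z ∈ (extChartAt (𝓡 n) x).target,
      fderiv ℝ (HeightFunction.height (e ∘ (extChartAt (𝓡 n) x).symm) a) z = 0 →
      Injective (fderiv ℝ (fderiv ℝ
        (HeightFunction.height (e ∘ (extChartAt (𝓡 n) x).symm) a)) z) := by
    rw [ae_ball_iff htc]
    intro x _
    have he2 : ContDiffOn ℝ 2 (e ∘ (extChartAt (𝓡 n) x).symm) (extChartAt (𝓡 n) x).target :=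
      (contMDiffOn_iff_contDiffOn.1 (he.comp_contMDiffOn (contMDiffOn_extChartAt_symm x))).of_le
        (by norm_cast)
    exact HeightFunction.ae_forall_injective_fderiv_fderiv_height μ (isOpen_extChartAt_target x)
      he2 (hinj x)
  filter_upwards [hgood] with a ha
  exact isMorse_inner_of_forall he htcover ha

end AeMorse

end Literature.Topology.FourManifolds
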